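import Summits.Schanuel.Schanuel.Theorems.RoyCriterionRoyThesisTypedRankThreeCMGamma
import Literature.Barriers.Schanuel.AlgebraicIndependenceOfLogarithms

/-!
# The lemniscatic triple `(ϖ, iϖ, π)` inhabits the rank-3 rung of Roy's criterion

Crux `stmt-Schanuel-0463` (`RoyThesisTyped = ∀ n, RoyCriterion n` ⟺ Schanuel). Line `SketchIdeator5R2`
(idea `cm-tau-companion-rank-three`), "the pretty instance": the lemniscatic period basis
`(ϖ, iϖ)` of round 1's period sector (`ϖ = Γ(1/4)²/(2√(2π)) = ∫₁^∞ du/√(u³ − u)`, half the real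
period of `y² = x³ − x`), extended by `π`, satisfies Schanuel's inequality in rank 3 and hence the
crux's rank-3 rung — from Nesterenko's theorem alone (`Γ(1/4)⁴ = 8πϖ²`), with no elliptic
transcendence input. Here `ϖ` is carried as a real parameter with its defining equation `hϖ`.

* `RoyThesisTyped.two_le_trdeg_lemniscate_pi`, `RoyThesisTyped.algebraicIndependent_lemniscate_pi` —
  `ϖ, π` are algebraically independent over `ℚ`;
* `RoyThesisTyped.linearIndependent_lemniscateTriple` — `(ϖ, iϖ, π)` is `ℚ`-linearly independent;
* `RoyThesisTyped.royCriterion_three_at_lemniscateTriple` — the crux's rank-3 rung at `(ϖ, iϖ, π)`: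
  for every `α ∈ (ℂˣ)³` and admissible window, `RoyHypothesis → 3 ≤ trdeg_ℚ ℚ(y, α)`.

No defs, no sorries, no named-fact hypotheses.
-/

set_option linter.dupNamespace false

noncomputable section

namespace Summit.Schanuel.Schanuel.Theorems

open Complex
open Literature.NumberTheory.Transcendental

/-- `2 ≤ trdeg_ℚ ℚ(ϖ, π)` for the lemniscatic period `ϖ = Γ(1/4)²/(2√(2π))`: `π` and `Γ(1/4)`
(algebraically independent, Nesterenko) are algebraic over `ℚ(ϖ, π)` since `Γ(1/4)⁴ = 8πϖ²`.
[cite: NesterenkoPhilippon2001, Ch. 3 Corollary 1.2] -/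
theorem RoyThesisTyped.two_le_trdeg_lemniscate_pi (ϖ : ℝ)
    (hϖ : ϖ = Real.Gamma (1 / 4) ^ 2 / (2 * Real.sqrt (2 * Real.pi))) :
    (2 : Cardinal) ≤ Algebra.trdeg ℚ
      ↥(IntermediateField.adjoin ℚ (Set.range ![(ϖ : ℂ), (Real.pi : ℂ)])) := by
  set K : IntermediateField ℚ ℂ := IntermediateField.adjoin ℚ (Set.range ![(ϖ : ℂ), (Real.pi : ℂ)])
    with hK
  set x : Fin 2 → ℂ := ![(Real.pi : ℂ), (Real.Gamma (1 / 4) : ℂ)] with hx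
  have hxind : AlgebraicIndependent ℚ x := by
    have h := RoyThesisTyped.algebraicIndependent_pi_expPi_gammaQuarter.comp ![(0 : Fin 3), 2]
      (by decide)
    convert h using 1
    funext k; fin_cases k <;> rfl
  have h2 : (2 : Cardinal) ≤ Algebra.trdeg ℚ ↥(IntermediateField.adjoin ℚ (Set.range x)) := by
    have h := RoyThesisTyped.natCast_le_trdeg_of_algebraicIndependent hxind
      (IntermediateField.adjoin ℚ (Set.range x))
      (fun k => IntermediateField.subset_adjoin ℚ _ ⟨k, rfl⟩)
    exact_mod_cast h
  refine h2.trans (PrasadRapinchuk.trdeg_adjoin_le_of_isAlgebraic K ?_)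
  have hϖK : (ϖ : ℂ) ∈ K := IntermediateField.subset_adjoin ℚ _ ⟨0, rfl⟩
  have hπK : (Real.pi : ℂ) ∈ K := IntermediateField.subset_adjoin ℚ _ ⟨1, rfl⟩
  rintro z ⟨k, rfl⟩
  fin_cases k
  · simp only [hx, Fin.zero_eta, Fin.isValue, Matrix.cons_val_zero]
    exact isAlgebraic_algebraMap (⟨_, hπK⟩ : K)
  · simp only [hx, Fin.mk_one, Fin.isValue, Matrix.cons_val_one, Matrix.cons_val_zero]
    have hreal : Real.Gamma (1 / 4) ^ 4 = ϖ ^ 2 * (8 * Real.pi) := by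
      have hs : Real.sqrt (2 * Real.pi) ^ 2 = 2 * Real.pi :=
        Real.sq_sqrt (by positivity : (0 : ℝ) ≤ 2 * Real.pi)
      have hs0 : Real.sqrt (2 * Real.pi) ≠ 0 := by positivity
      rw [hϖ]
      field_simp
      rw [hs]
      ring
    have h4 : (Real.Gamma (1 / 4) : ℂ) ^ 4 = (ϖ : ℂ) ^ 2 * (8 * (Real.pi : ℂ)) := by
      rw [← Complex.ofReal_pow, hreal]
      push_cast
      ring
    have hmem : (Real.Gamma (1 / 4) : ℂ) ^ 4 ∈ K := by
      rw [h4]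
      exact mul_mem (pow_mem hϖK 2) (mul_mem (ofNat_mem K 8) hπK)
    exact IsAlgebraic.of_pow (by norm_num : 0 < 4) (isAlgebraic_algebraMap (⟨_, hmem⟩ : K))

/-- **`ϖ` and `π` are algebraically independent over `ℚ`** (as complex numbers): a pair generating
a field of transcendence degree `≥ 2` is algebraically independent
(`Literature.Barriers.Schanuel.algebraicIndependent_of_le_trdeg_adjoin`).
[cite: NesterenkoPhilippon2001, Ch. 3 Corollary 1.2] -/
theorem RoyThesisTyped.algebraicIndependent_lemniscate_pi (ϖ : ℝ)
    (hϖ : ϖ = Real.Gamma (1 / 4) ^ 2 / (2 * Real.sqrt (2 * Real.pi))) :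
    AlgebraicIndependent ℚ ![(ϖ : ℂ), (Real.pi : ℂ)] :=
  Literature.Barriers.Schanuel.algebraicIndependent_of_le_trdeg_adjoin _
    (by exact_mod_cast RoyThesisTyped.two_le_trdeg_lemniscate_pi ϖ hϖ)

/-- **The lemniscatic triple `(ϖ, iϖ, π)` is `ℚ`-linearly independent**: the imaginary part
isolates the coefficient of `iϖ` (`ϖ > 0`), and a `ℚ`-relation between `ϖ` and `π` would be an
algebraic one (`algebraicIndependent_lemniscate_pi`). [cite: NesterenkoPhilippon2001, Ch. 3 Corollary 1.2] -/
theorem RoyThesisTyped.linearIndependent_lemniscateTriple (ϖ : ℝ)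
    (hϖ : ϖ = Real.Gamma (1 / 4) ^ 2 / (2 * Real.sqrt (2 * Real.pi))) :
    LinearIndependent ℚ ![(ϖ : ℂ), (ϖ : ℂ) * I, (Real.pi : ℂ)] := by
  have hϖpos : 0 < ϖ := by
    rw [hϖ]
    have hΓ : 0 < Real.Gamma (1 / 4) := Real.Gamma_pos_of_pos (by norm_num)
    positivity
  -- real algebraic (hence linear) independence of `(ϖ, π)`
  have hpairC := RoyThesisTyped.algebraicIndependent_lemniscate_pi ϖ hϖ
  have hpairR : AlgebraicIndependent ℚ ![ϖ, Real.pi] := by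
    refine AlgebraicIndependent.of_comp (Complex.ofRealAm.restrictScalars ℚ) ?_
    convert hpairC using 1
    funext k; fin_cases k <;> simp
  have hpair : LinearIndependent ℚ ![ϖ, Real.pi] := hpairR.linearIndependent
  rw [Fintype.linearIndependent_iff]
  intro g hg
  rw [Fin.sum_univ_three] at hg
  simp only [Matrix.cons_val_zero, Matrix.cons_val_one, Matrix.cons_val] at hg
  have hre := congrArg Complex.re hg
  have him := congrArg Complex.im hg
  simp only [Complex.add_re, Complex.add_im, Rat.smul_def, Complex.mul_re, Complex.mul_im,
    Complex.ofReal_re, Complex.ofReal_im, Complex.I_re, Complex.I_im, Complex.ratCast_re,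
    Complex.ratCast_im, Complex.zero_re, Complex.zero_im, mul_zero, mul_one, sub_zero, add_zero,
    zero_add, zero_mul, sub_self] at hre him
  -- `him : (g 1 : ℝ) * ϖ = 0`, `hre : (g 0 : ℝ) * ϖ + (g 2 : ℝ) * π = 0`
  have h1 : g 1 = 0 := by
    rcases mul_eq_zero.mp him with h | h
    · exact_mod_cast h
    · exact absurd h hϖpos.ne'
  have h02 : g 0 = 0 ∧ g 2 = 0 := by
    have hp := (LinearIndependent.pair_iff.mp hpair) (g 0) (g 2)
    refine hp ?_
    simp only [Rat.smul_def]
    exact_mod_cast hre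
  intro k
  fin_cases k
  · exact h02.1
  · exact h1
  · exact h02.2

/-- **The lemniscatic instance of the crux's rank-3 rung.** At `y = (ϖ, iϖ, π)` —
`ℚ`-linearly independent — for every `α ∈ (ℂˣ)³` and every admissible window,
`RoyHypothesis y α … → 3 ≤ trdeg_ℚ ℚ(y, α)` (`three_le_trdeg_of_royHypothesis_of_pi_lemniscate`:
`Γ(1/4)⁴ = 8πϖ²`, Nesterenko, pointwise Roy transfer). No elliptic (Chudnovsky/Tubbs) input.
[cite: Roy2001, Conjecture 2] [cite: NesterenkoPhilippon2001, Ch. 3 Corollary 1.2] -/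
theorem RoyThesisTyped.royCriterion_three_at_lemniscateTriple (ϖ : ℝ)
    (hϖ : ϖ = Real.Gamma (1 / 4) ^ 2 / (2 * Real.sqrt (2 * Real.pi))) :
    LinearIndependent ℚ ![(ϖ : ℂ), (ϖ : ℂ) * I, (Real.pi : ℂ)] ∧
    ∀ α : Fin 3 → ℂ, (∀ j, α j ≠ 0) → ∀ (s₀ s₁ t₀ t₁ u : ℝ), RoyAdmissible s₀ s₁ t₀ t₁ u →
      RoyHypothesis ![(ϖ : ℂ), (ϖ : ℂ) * I, (Real.pi : ℂ)] α s₀ s₁ t₀ t₁ u →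
        ((3 : ℕ) : Cardinal) ≤ Algebra.trdeg ℚ
          ↥(IntermediateField.adjoin ℚ
            (Set.range ![(ϖ : ℂ), (ϖ : ℂ) * I, (Real.pi : ℂ)] ∪ Set.range α)) := by
  refine ⟨RoyThesisTyped.linearIndependent_lemniscateTriple ϖ hϖ,
    fun α hα s₀ s₁ t₀ t₁ u hadm hhyp => ?_⟩
  have hj : (![(ϖ : ℂ), (ϖ : ℂ) * I, (Real.pi : ℂ)] : Fin 3 → ℂ) 0 =
      ((Real.Gamma (1 / 4) ^ 2 / (2 * Real.sqrt (2 * Real.pi)) : ℝ) : ℂ) := by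
    simp [hϖ]
  exact_mod_cast RoyThesisTyped.three_le_trdeg_of_royHypothesis_of_pi_lemniscate
    (y := ![(ϖ : ℂ), (ϖ : ℂ) * I, (Real.pi : ℂ)]) 2 0 (by simp) hj hα hadm hhyp

end Summit.Schanuel.Schanuel.Theorems

end
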